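import Mathlib
import HarnessLib
import Literature.AlgebraicGeometry.Resolution.RegularLocalRingsFlatDescent
import Literature.RingTheory.GaloisAlgebras.ChaseHarrisonRosenberg
import Summits.ResolutionOfSingularities.ResolutionOfSingularities.Theorems.WildQuotientsWildQuotientResolutionS1aInvariantsLocalization

/-!
# S1a — (T2e, N3a) the ring of invariants at MOVED primes: free localised action, flatness, descent of regularity

[OURS · L1 W4.5c · lead-1 g7; T2E-BRIEF (N3), moved primes] — NOT statements of the manuscript; counted 0; AI-level work,
weaker than expert review. Crux stmt-ResolutionOfSingularities-17941, line `s1a-logminvertex` v6, stub `stub_winningStrategy`.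

Setting: `τ : C ≃+* C` with `τ^[p] = id` (`p` prime), `A = invariantSubring τ`, `𝔮` a prime of `A` such that the primes of `C`
over `𝔮` are MOVED by `τ` (free orbit). With `Aq = A_𝔮`, `Cq` any localisation of `C` at the image of `A ∖ 𝔮` and `τq` an
automorphism of `Cq` extending `τ`:
* `isInvariant_loc` — `(Cq)^{⟨τq⟩} = Aq` (from (N1));
* `span_sub_eq_top_of_moved` — the action of `⟨τq⟩` on `Cq` is FREE: for `g ≠ 1` the `g x - x` generate the unit ideal
  (a maximal ideal containing them contracts to a `τ`-STABLE prime of `C` over `𝔮`: `liesOver_of_isMaximal`, going-up for `A ⊆ C`);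
* `flat_loc_of_moved` — hence `Cq` is a flat `Aq`-module (tree `Literature.RingTheory.GaloisAlgebras.flat_of_free`, CHR Thm 1.3);
* `flat_localRingHom_of_moved` — `A_𝔮 → C_𝔓` is flat for every `𝔓` over `𝔮`, so
  `isRegularLocalRing_atPrime_of_moved`: `C_𝔓` regular ⇒ `A_𝔮` regular (tree `IsRegularLocalRing.of_flat_ringHom`, Matsumura 23.7).
-/

set_option linter.dupNamespace false

noncomputable section

namespace Summit.ResolutionOfSingularities.ResolutionOfSingularities.Theorems.WildQuotientResolution.S1.InvariantsRegular

open Literature.AlgebraicGeometry.Resolution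
open scoped Pointwise

universe u

variable {C : Type u} [CommRing C] (τ : C ≃+* C)

/-- `τ^[p] = id ⇒ τ^[p n] = id`. -/
theorem iterate_mul_apply_eq_self {p : ℕ} (hτp : ∀ x : C, τ^[p] x = x) (n : ℕ) (x : C) : τ^[p * n] x = x := by
  induction n with
  | zero => simp
  | succ n ih => rw [Nat.mul_succ, Function.iterate_add_apply, hτp, ih]

/-- Forward `τ`-stability of an ideal is two-sided stability when `τ^[p] = id`, `0 < p`. -/
theorem stable_iff_of_forall_mem {p : ℕ} (hp : 0 < p) (hτp : ∀ x : C, τ^[p] x = x) {P : Ideal C}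
    (hP : ∀ c ∈ P, τ c ∈ P) (c : C) : c ∈ P ↔ τ c ∈ P := by
  refine ⟨hP c, fun h => ?_⟩
  have hn : ∀ n : ℕ, τ^[n] (τ c) ∈ P := by
    intro n
    induction n with
    | zero => exact h
    | succ n ih => rw [Function.iterate_succ_apply']; exact hP _ ih
  have := hn (p - 1)
  rwa [← Function.iterate_succ_apply, Nat.succ_eq_add_one, Nat.sub_add_cancel (Nat.one_le_of_lt hp), hτp] at this

section Loc

variable (𝔮 : Ideal (invariantSubring τ)) [𝔮.IsPrime] (Cq : Type u) [CommRing Cq] [Algebra C Cq] (τq : Cq ≃+* Cq)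

/-- The denominators `A ∖ 𝔮` are `τ`-fixed. -/
theorem algebraMapSubmonoid_fixed : ∀ t ∈ Algebra.algebraMapSubmonoid C 𝔮.primeCompl, τ t = t := by
  rintro _ ⟨a, -, rfl⟩
  exact a.2

/-- Iterates of an extension `τq` of `τ` on the image of `C`. -/
theorem loc_iterate_algebraMap (hτq : ∀ c : C, τq (algebraMap C Cq c) = algebraMap C Cq (τ c)) (k : ℕ) (c : C) :
    τq^[k] (algebraMap C Cq c) = algebraMap C Cq (τ^[k] c) := by
  induction k generalizing c with
  | zero => rfl
  | succ k ih => rw [Function.iterate_succ_apply, Function.iterate_succ_apply, hτq, ih]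

/-- `τ^[p] = id ⇒ τq^[p] = id` on a localisation `Cq` of `C`. -/
theorem loc_iterate_eq_self (S : Submonoid C) [IsLocalization S Cq]
    (hτq : ∀ c : C, τq (algebraMap C Cq c) = algebraMap C Cq (τ c)) {p : ℕ} (hτp : ∀ x : C, τ^[p] x = x) (x : Cq) :
    τq^[p] x = x := by
  obtain ⟨c, t, rfl⟩ := IsLocalization.exists_mk'_eq S x
  have hU : IsUnit (algebraMap C Cq (t : C)) := IsLocalization.map_units Cq t
  have hspec : IsLocalization.mk' Cq c t * algebraMap C Cq (t : C) = algebraMap C Cq c := IsLocalization.mk'_spec Cq c t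
  have key : τq^[p] (IsLocalization.mk' Cq c t) * algebraMap C Cq (t : C) = algebraMap C Cq c := by
    have := congrArg (⇑τq)^[p] hspec
    rw [iterate_map_mul, loc_iterate_algebraMap τ Cq τq hτq, loc_iterate_algebraMap τ Cq τq hτq, hτp, hτp] at this
    exact this
  exact hU.mul_left_injective (key.trans hspec.symm)

variable [IsLocalization (Algebra.algebraMapSubmonoid C 𝔮.primeCompl) Cq]
  [Algebra (invariantSubring τ) Cq] [IsScalarTower (invariantSubring τ) C Cq]
  [Algebra (Localization.AtPrime 𝔮) Cq] [IsScalarTower (invariantSubring τ) (Localization.AtPrime 𝔮) Cq]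

omit [IsLocalization (Algebra.algebraMapSubmonoid C 𝔮.primeCompl) Cq] in
/-- The image of `Aq` in `Cq` is fixed by an extension `τq` of `τ`. -/
theorem loc_apply_algebraMap (hτq : ∀ c : C, τq (algebraMap C Cq c) = algebraMap C Cq (τ c))
    (a : Localization.AtPrime 𝔮) : τq (algebraMap _ Cq a) = algebraMap _ Cq a := by
  have h : ((τq : Cq →+* Cq).comp (algebraMap (Localization.AtPrime 𝔮) Cq)).comp
      (algebraMap (invariantSubring τ) (Localization.AtPrime 𝔮)) =
      (algebraMap (Localization.AtPrime 𝔮) Cq).comp (algebraMap (invariantSubring τ) (Localization.AtPrime 𝔮)) := by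
    ext a
    simp only [RingHom.coe_comp, RingHom.coe_coe, Function.comp_apply]
    rw [← IsScalarTower.algebraMap_apply (invariantSubring τ) (Localization.AtPrime 𝔮) Cq,
      IsScalarTower.algebraMap_apply (invariantSubring τ) C Cq, hτq]
    exact congrArg _ a.2
  exact congrArg (fun f => f a) (IsLocalization.ringHom_ext 𝔮.primeCompl h)

/-- **`(Cq)^{⟨τq⟩} = Aq`** — Mathlib's `Algebra.IsInvariant` for the localised action, from (N1). [OURS · L1 W4.5c] -/
theorem isInvariant_loc (hτq : ∀ c : C, τq (algebraMap C Cq c) = algebraMap C Cq (τ c)) :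
    Algebra.IsInvariant (Localization.AtPrime 𝔮) Cq (Subgroup.zpowers τq) := by
  refine ⟨fun x hx => ?_⟩
  have hx' : τq x = x := hx ⟨τq, Subgroup.mem_zpowers τq⟩
  obtain ⟨c, t, hc, rfl⟩ := exists_fixed_mk'_of_apply_eq τ (Algebra.algebraMapSubmonoid C 𝔮.primeCompl)
    (algebraMapSubmonoid_fixed τ 𝔮) (τq : Cq →+* Cq) hτq hx'
  obtain ⟨_, ⟨s, hs, rfl⟩⟩ := t
  refine ⟨IsLocalization.mk' (Localization.AtPrime 𝔮) (⟨c, hc⟩ : invariantSubring τ) ⟨s, hs⟩, ?_⟩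
  rw [IsLocalization.algebraMap_mk' C (Localization.AtPrime 𝔮) Cq]
  rfl

omit [IsLocalization (Algebra.algebraMapSubmonoid C 𝔮.primeCompl) Cq] in
/-- The action of `⟨τq⟩` commutes with the `Aq`-scalars. -/
theorem smulCommClass_loc (hτq : ∀ c : C, τq (algebraMap C Cq c) = algebraMap C Cq (τ c)) :
    SMulCommClass (Subgroup.zpowers τq) (Localization.AtPrime 𝔮) Cq :=
  ⟨fun g a x => by
    rw [Algebra.smul_def, Algebra.smul_def, smul_mul', smul_eq_self_of_apply_eq τq (loc_apply_algebraMap τ 𝔮 Cq τq hτq a) g]⟩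

omit τq in
/-- `Aq → Cq` is injective. -/
theorem faithfulSMul_loc : FaithfulSMul (Localization.AtPrime 𝔮) Cq := by
  rw [faithfulSMul_iff_algebraMap_injective]
  have h : algebraMap (Localization.AtPrime 𝔮) Cq =
      IsLocalization.map Cq (algebraMap (invariantSubring τ) C)
        (show 𝔮.primeCompl ≤ (Algebra.algebraMapSubmonoid C 𝔮.primeCompl).comap _ from Submonoid.le_comap_map _) :=
    IsLocalization.ringHom_ext 𝔮.primeCompl (by
      ext a
      simp only [RingHom.coe_comp, Function.comp_apply, IsLocalization.map_eq]
      rw [← IsScalarTower.algebraMap_apply (invariantSubring τ) (Localization.AtPrime 𝔮) Cq,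
        IsScalarTower.algebraMap_apply (invariantSubring τ) C Cq])
  rw [h]
  haveI : IsLocalization (𝔮.primeCompl.map (algebraMap (invariantSubring τ) C)) Cq :=
    ‹IsLocalization (Algebra.algebraMapSubmonoid C 𝔮.primeCompl) Cq›
  exact IsLocalization.map_injective_of_injective _ _ _ Subtype.val_injective

omit τq [Algebra (invariantSubring τ) Cq] [IsScalarTower (invariantSubring τ) C Cq] [Algebra (Localization.AtPrime 𝔮) Cq]
  [IsScalarTower (invariantSubring τ) (Localization.AtPrime 𝔮) Cq] in
/-- The contraction of a maximal ideal of `Cq` lies over `𝔮` itself (going-up for the integral extension `A ⊆ C`). -/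
theorem liesOver_of_isMaximal {p : ℕ} (hp : 0 < p) (hτp : ∀ x : C, τ^[p] x = x) (𝔪 : Ideal Cq) [h𝔪 : 𝔪.IsMaximal] :
    (𝔪.comap (algebraMap C Cq)).LiesOver 𝔮 := by
  haveI := isIntegral_invariantSubring τ hp hτp
  have hPd := (IsLocalization.isPrime_iff_isPrime_disjoint (Algebra.algebraMapSubmonoid C 𝔮.primeCompl) Cq 𝔪).mp
    h𝔪.isPrime
  haveI : (𝔪.comap (algebraMap C Cq)).IsPrime := hPd.1
  -- `P ∩ A ⊆ 𝔮`
  have hle : (𝔪.comap (algebraMap C Cq)).comap (algebraMap (invariantSubring τ) C) ≤ 𝔮 := by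
    intro a ha
    by_contra hna
    exact Set.disjoint_left.mp hPd.2 ⟨a, hna, rfl⟩ ha
  obtain ⟨Q, hPQ, hQ, hQ𝔮⟩ := Ideal.exists_ideal_over_prime_of_isIntegral 𝔮 (𝔪.comap (algebraMap C Cq)) hle
  -- `Q` misses `A ∖ 𝔮`, so `Q Cq` is a proper (prime) ideal above `𝔪`, hence `= 𝔪`, and `Q = P`
  have hQd : Disjoint (Algebra.algebraMapSubmonoid C 𝔮.primeCompl : Set C) Q := by
    refine Set.disjoint_left.mpr ?_
    rintro _ ⟨a, ha, rfl⟩ haQ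
    exact ha (by rw [← hQ𝔮]; exact haQ)
  have hQmap : (Q.map (algebraMap C Cq)).IsPrime :=
    IsLocalization.isPrime_of_isPrime_disjoint (Algebra.algebraMapSubmonoid C 𝔮.primeCompl) Cq Q hQ hQd
  have h𝔪le : 𝔪 ≤ Q.map (algebraMap C Cq) := by
    rw [← IsLocalization.map_under (Algebra.algebraMapSubmonoid C 𝔮.primeCompl) Cq 𝔪]
    exact Ideal.map_mono hPQ
  have h𝔪eq : 𝔪 = Q.map (algebraMap C Cq) := h𝔪.eq_of_le hQmap.ne_top h𝔪le
  have hQP : Q = 𝔪.comap (algebraMap C Cq) := by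
    rw [h𝔪eq]
    exact (IsLocalization.under_map_of_isPrime_disjoint (Algebra.algebraMapSubmonoid C 𝔮.primeCompl) Cq hQ hQd).symm
  exact ⟨by rw [Ideal.under_def, ← hQP, hQ𝔮]⟩

omit [Algebra (invariantSubring τ) Cq] [IsScalarTower (invariantSubring τ) C Cq] [Algebra (Localization.AtPrime 𝔮) Cq]
  [IsScalarTower (invariantSubring τ) (Localization.AtPrime 𝔮) Cq] in
/-- **Freeness of the localised action at MOVED primes**: if every prime of `C` over `𝔮` is moved by `τ`, then for every
`g ≠ 1` in `⟨τq⟩` the elements `g x - x` generate the unit ideal of `Cq`. [OURS · L1 W4.5c] -/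
theorem span_sub_eq_top_of_moved (hτq : ∀ c : C, τq (algebraMap C Cq c) = algebraMap C Cq (τ c))
    {p : ℕ} (hp : p.Prime) (hτp : ∀ x : C, τ^[p] x = x)
    (hmoved : ∀ (P : Ideal C) [P.IsPrime] [P.LiesOver 𝔮], ∃ x ∈ P, τ x ∉ P)
    (g : Subgroup.zpowers τq) (hg : g ≠ 1) : Ideal.span (Set.range fun x : Cq => g • x - x) = ⊤ := by
  by_contra hne
  obtain ⟨𝔪, h𝔪, hle⟩ := Ideal.exists_le_maximal _ hne
  -- `g = τq ^ k` with `0 < k < p`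
  obtain ⟨k, hkp, hgk⟩ := exists_pow_eq_of_mem_zpowers τq hp.pos
    (loc_iterate_eq_self τ Cq τq (Algebra.algebraMapSubmonoid C 𝔮.primeCompl) hτq hτp) g
  have hk0 : k ≠ 0 := by
    rintro rfl
    exact hg (Subtype.ext (hgk.trans (pow_zero τq)))
  -- the contraction `P` of `𝔪` is stable under `τ^[k]` …
  have hstabk : ∀ c ∈ 𝔪.comap (algebraMap C Cq), τ^[k] c ∈ 𝔪.comap (algebraMap C Cq) := by
    intro c hc
    have h1 : g • algebraMap C Cq c - algebraMap C Cq c ∈ 𝔪 := hle (Ideal.subset_span ⟨_, rfl⟩)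
    have h2 := 𝔪.add_mem h1 (hc : algebraMap C Cq c ∈ 𝔪)
    rw [sub_add_cancel] at h2
    have h3 : g • algebraMap C Cq c = algebraMap C Cq (τ^[k] c) := by
      change (g : Cq ≃+* Cq) (algebraMap C Cq c) = _
      rw [hgk, pow_apply, loc_iterate_algebraMap τ Cq τq hτq]
    rw [h3] at h2
    exact h2
  -- … hence under every `τ^[k n]`, in particular under `τ` (`k` is invertible mod `p`)
  have hstabkn : ∀ (n : ℕ), ∀ c ∈ 𝔪.comap (algebraMap C Cq), τ^[k * n] c ∈ 𝔪.comap (algebraMap C Cq) := by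
    intro n
    induction n with
    | zero => intro c hc; exact hc
    | succ n ih => intro c hc; rw [Nat.mul_succ, Function.iterate_add_apply]; exact ih _ (hstabk c hc)
  have hstab : ∀ c ∈ 𝔪.comap (algebraMap C Cq), τ c ∈ 𝔪.comap (algebraMap C Cq) := by
    obtain ⟨m, -, hm⟩ := Nat.exists_mul_mod_eq_one_of_coprime (Nat.coprime_of_lt_prime hk0 hkp hp).symm hp.one_lt
    intro c hc
    have h1 := hstabkn m c hc
    have h2 : k * m = 1 + p * (k * m / p) := by
      have := Nat.mod_add_div (k * m) p
      rw [hm] at this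
      exact this.symm
    rwa [h2, Function.iterate_add_apply, iterate_mul_apply_eq_self τ hτp] at h1
  have hstab' := stable_iff_of_forall_mem τ hp.pos hτp hstab
  -- but `P` lies over `𝔮`, where every prime is moved
  haveI := liesOver_of_isMaximal τ 𝔮 Cq hp.pos hτp 𝔪
  haveI : (𝔪.comap (algebraMap C Cq)).IsPrime := Ideal.IsPrime.comap _
  obtain ⟨x, hx, hτx⟩ := hmoved (𝔪.comap (algebraMap C Cq))
  exact hτx ((hstab' x).mp hx)

/-- **Flatness at moved primes**: `Cq` is a flat `Aq`-module (Chase–Harrison–Rosenberg via the tree's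
`Literature.RingTheory.GaloisAlgebras.flat_of_free`). [OURS · L1 W4.5c] -/
theorem flat_loc_of_moved (hτq : ∀ c : C, τq (algebraMap C Cq c) = algebraMap C Cq (τ c))
    {p : ℕ} (hp : p.Prime) (hτp : ∀ x : C, τ^[p] x = x)
    (hmoved : ∀ (P : Ideal C) [P.IsPrime] [P.LiesOver 𝔮], ∃ x ∈ P, τ x ∉ P) :
    Module.Flat (Localization.AtPrime 𝔮) Cq := by
  haveI := finite_zpowers_of_iterate_eq τq hp.pos
    (loc_iterate_eq_self τ Cq τq (Algebra.algebraMapSubmonoid C 𝔮.primeCompl) hτq hτp)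
  letI : Fintype (Subgroup.zpowers τq) := Fintype.ofFinite _
  haveI := isInvariant_loc τ 𝔮 Cq τq hτq
  haveI := smulCommClass_loc τ 𝔮 Cq τq hτq
  haveI := faithfulSMul_loc τ 𝔮 Cq
  exact Literature.RingTheory.GaloisAlgebras.flat_of_free (Localization.AtPrime 𝔮) (Subgroup.zpowers τq)
    (span_sub_eq_top_of_moved τ 𝔮 Cq τq hτq hp hτp hmoved)

end Loc

/-! ## From `Cq` to `C_𝔓`: the flat local homomorphism `A_𝔮 → C_𝔓` and descent of regularity -/

section AtPrime

variable (𝔓 : Ideal C) [𝔓.IsPrime] (𝔮 : Ideal (invariantSubring τ)) [𝔮.IsPrime] [𝔓.LiesOver 𝔮]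

omit [𝔓.IsPrime] [𝔓.LiesOver 𝔮] in
/-- The denominators `A ∖ 𝔮` are preserved by `τ` (they are fixed). -/
theorem map_algebraMapSubmonoid_eq :
    (Algebra.algebraMapSubmonoid C 𝔮.primeCompl).map τ.toMonoidHom = Algebra.algebraMapSubmonoid C 𝔮.primeCompl := by
  ext x
  constructor
  · rintro ⟨y, hy, rfl⟩
    change τ y ∈ _
    rw [algebraMapSubmonoid_fixed τ 𝔮 y hy]
    exact hy
  · intro hx
    exact ⟨x, hx, (algebraMapSubmonoid_fixed τ 𝔮 x hx : τ x = x)⟩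

/-- **The flat local homomorphism at a moved prime**: `A_𝔮 → C_𝔓` (Mathlib `Localization.localRingHom`) is flat when the
primes over `𝔮` are moved by `τ`. [OURS · L1 W4.5c] -/
theorem flat_localRingHom_of_moved {p : ℕ} (hp : p.Prime) (hτp : ∀ x : C, τ^[p] x = x)
    (hmoved : ∀ (P : Ideal C) [P.IsPrime] [P.LiesOver 𝔮], ∃ x ∈ P, τ x ∉ P) :
    (Localization.localRingHom 𝔮 𝔓 (algebraMap (invariantSubring τ) C) Ideal.LiesOver.over).Flat := by
  let S := Algebra.algebraMapSubmonoid C 𝔮.primeCompl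
  let τq : Localization S ≃+* Localization S :=
    IsLocalization.ringEquivOfRingEquiv (Localization S) (Localization S) τ (map_algebraMapSubmonoid_eq τ 𝔮)
  have hτq : ∀ c : C, τq (algebraMap C (Localization S) c) = algebraMap C (Localization S) (τ c) := fun c =>
    IsLocalization.ringEquivOfRingEquiv_eq _ c
  -- `Aq → Cq` is flat
  have h1 : (algebraMap (Localization.AtPrime 𝔮) (Localization S)).Flat := by
    rw [RingHom.flat_algebraMap_iff]
    exact flat_loc_of_moved τ 𝔮 (Localization S) τq hτq hp hτp hmoved
  -- `Cq → C_𝔓` is a localisation, hence flat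
  letI : Algebra (Localization S) (Localization.AtPrime 𝔓) :=
    IsLocalization.localizationAlgebraOfSubmonoidLe (Localization S) (Localization.AtPrime 𝔓) S 𝔓.primeCompl
      (algebraMapSubmonoid_le_primeCompl τ 𝔓 𝔮)
  haveI : IsScalarTower C (Localization S) (Localization.AtPrime 𝔓) :=
    IsLocalization.localization_isScalarTower_of_submonoid_le (Localization S) (Localization.AtPrime 𝔓) S 𝔓.primeCompl
      (algebraMapSubmonoid_le_primeCompl τ 𝔓 𝔮)
  haveI : IsLocalization (𝔓.primeCompl.map (algebraMap C (Localization S))) (Localization.AtPrime 𝔓) :=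
    IsLocalization.isLocalization_of_submonoid_le (Localization S) (Localization.AtPrime 𝔓) S 𝔓.primeCompl
      (algebraMapSubmonoid_le_primeCompl τ 𝔓 𝔮)
  have h2 : (algebraMap (Localization S) (Localization.AtPrime 𝔓)).Flat := by
    rw [RingHom.flat_algebraMap_iff]
    exact IsLocalization.flat (Localization.AtPrime 𝔓) (𝔓.primeCompl.map (algebraMap C (Localization S)))
  -- the composite is `localRingHom`
  have h3 : (algebraMap (Localization S) (Localization.AtPrime 𝔓)).comp
      (algebraMap (Localization.AtPrime 𝔮) (Localization S)) =
      Localization.localRingHom 𝔮 𝔓 (algebraMap (invariantSubring τ) C) Ideal.LiesOver.over := by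
    refine IsLocalization.ringHom_ext 𝔮.primeCompl ?_
    ext a
    simp only [RingHom.coe_comp, Function.comp_apply, Localization.localRingHom_to_map]
    rw [← IsScalarTower.algebraMap_apply (invariantSubring τ) (Localization.AtPrime 𝔮) (Localization S),
      IsScalarTower.algebraMap_apply (invariantSubring τ) C (Localization S),
      ← IsScalarTower.algebraMap_apply C (Localization S) (Localization.AtPrime 𝔓)]
  rw [← h3]
  exact RingHom.Flat.comp h1 h2

/-- **Descent of regularity at a moved prime** (Matsumura 23.7 via the tree's `IsRegularLocalRing.of_flat_ringHom`): if `A` is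
Noetherian, `C_𝔓` is a regular local ring and the primes over `𝔮 = 𝔓 ∩ A` are moved by `τ`, then `A_𝔮` is a regular local ring.
[OURS · L1 W4.5c] -/
theorem isRegularLocalRing_atPrime_of_moved [IsNoetherianRing (invariantSubring τ)]
    [IsRegularLocalRing (Localization.AtPrime 𝔓)] {p : ℕ} (hp : p.Prime) (hτp : ∀ x : C, τ^[p] x = x)
    (hmoved : ∀ (P : Ideal C) [P.IsPrime] [P.LiesOver 𝔮], ∃ x ∈ P, τ x ∉ P) :
    IsRegularLocalRing (Localization.AtPrime 𝔮) :=
  IsRegularLocalRing.of_flat_ringHom _ (flat_localRingHom_of_moved τ 𝔓 𝔮 hp hτp hmoved)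

end AtPrime

end Summit.ResolutionOfSingularities.ResolutionOfSingularities.Theorems.WildQuotientResolution.S1.InvariantsRegular

end
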